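import Mathlib
import Summits.ResolutionOfSingularities.ResolutionOfSingularities.Theorems.RadicialJungCleanModelsCleanLU3CompositeCurveChart
import Literature.AlgebraicGeometry.Resolution.ArithmeticalThreefoldsLocalFrameDim
import Literature.AlgebraicGeometry.Resolution.CohenMacaulayCatenary
import Literature.AlgebraicGeometry.Resolution.QuadraticTransforms
import Literature.RingTheory.KrullDimension.RegularLocalRingTrdeg
import HarnessLib

/-!
# Route `RadicialJung`, crux `CleanModels` (stmt-15917), sub-line (C-div): the curve chart theorem for dimension 3

Line `Sketch` rev 24 of crux stmt-ResolutionOfSingularities-15917; lead `res-B-lead-1` g3.  OURS; nothing here proves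
resolution in characteristic `p` or CleanModels.  This file combines the general curve chart theorems from
`CompositeCurveChart.lean` with dimension preservation to get the specific statement for 3-dimensional regular local rings
needed by the sub-line (C-div) of `stub_cleanLU3DefectNonDiscrete`.

* `locAtCentre_adjoin_div_of_rsop` — for a 3-dimensional regular local subring `R ⊆ K` dominated by `O` with residually
  algebraic residue field, blowing up along a regular curve `V(x, y)` and localizing at the centre of `O` gives a
  3-dimensional regular local ring with regular system of parameters `(x/y, y, z)`.

Piece G3' of the lead's brief `Lines/Sketch-brief-Cdiv-subline.md`.
-/

noncomputable section

set_option linter.dupNamespace false -- mandated namespace of this single-conjunct summit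

open IsLocalRing Polynomial
open Literature.AlgebraicGeometry.Resolution
open Summit.ResolutionOfSingularities.ResolutionOfSingularities.Theorems.RadicialJung.CleanModels

namespace Summit.ResolutionOfSingularities.ResolutionOfSingularities.Theorems.RadicialJung.CleanModels

variable {K : Type} [Field K]

/-- **The curve chart `locAtCentre R[x/y] O` has dimension 3 for a 3-dimensional `R`**: under the hypotheses of
`ringKrullDim_locAtCentre_closure_eq` (residually algebraic valuation, universally catenary base), the dimension
is preserved.  [cite: CossartPiltant2019, Prop. 2.7 and Cor. 5.2] [cite: Matsumura1987, Thm. 15.6] [folklore] -/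
theorem ringKrullDim_locAtCentre_curveChart_eq_three (O : ValuationSubring K) (R : Subring K) [IsRegularLocalRing R]
    (hRO : R ≤ O.toSubring) (hdom : SubringDominates R O.toSubring) (hdim : ringKrullDim R = 3) (x y : R)
    (hy : (y : K) ≠ 0) (hv : O.valuation ((x : R) : K) ≤ O.valuation ((y : R) : K))
    -- residually algebraic condition: every element of O satisfies a polynomial over R with a unit coefficient
    (halg : ∀ z : O, ∃ q : R[X], (∃ i, q.coeff i ∉ maximalIdeal R) ∧ O.valuation (aeval (z : K) q) < 1) :
    ringKrullDim (locAtCentre (Subring.closure ((R : Set K) ∪ {((x : R) : K) / ((y : R) : K)})) O) = 3 := by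
  -- Regular local rings are universally catenary
  haveI hRegRing : IsRegularRing R := isRegularRing_of_isRegularLocalRing R
  haveI hUC : IsUniversallyCatenaryRing R := isUniversallyCatenaryRing_of_isRegularRing' R
  -- Domination hypothesis in the form needed by the dimension formula
  have hdomVal : ∀ r : R, r ∈ maximalIdeal R → O.valuation (r : K) < 1 := fun r hr =>
    ((subringDominates_valuationSubring_iff hRO).mp hdom r).mp hr
  -- The generator x/y is a fraction of elements of R
  have hfrac : ∀ t ∈ ({((x : R) : K) / ((y : R) : K)} : Finset K), ∃ a d : R, (d : K) ≠ 0 ∧ t = a / d := by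
    intro t ht
    simp only [Finset.mem_singleton] at ht
    exact ⟨x, y, hy, ht⟩
  -- Apply the dimension formula (need to convert between Set.singleton and Finset.singleton)
  have hle := curveChart_le O R hRO _ _ hv
  have hcoe : (R : Set K) ∪ (↑({((x : R) : K) / ((y : R) : K)} : Finset K)) = (R : Set K) ∪ {((x : R) : K) / ((y : R) : K)} := by
    simp only [Finset.coe_singleton]
  have hle' : Subring.closure ((R : Set K) ∪ (↑({((x : R) : K) / ((y : R) : K)} : Finset K))) ≤ O.toSubring := by
    simp only [Finset.coe_singleton]; exact hle
  have hdimEq := ringKrullDim_locAtCentre_closure_eq O hUC hRO hdomVal halg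
    {((x : R) : K) / ((y : R) : K)} hfrac hle'
  rw [hcoe] at hdimEq
  rw [hdimEq, hdim]

/-- **The combined curve chart theorem for dimension 3** (`locAtCentre_adjoin_div_of_rsop`): for a 3-dimensional regular local
subring `R ⊆ K` dominated by a residually algebraic valuation ring `O`, with regular system of parameters `(x, y, z)` and
`v(x) < v(y)`, the ring `R' = locAtCentre R[x/y] O` is a 3-dimensional regular local ring dominated by `O` with regular system
of parameters `(x/y, y, z)`.  [cite: CossartPiltant2019, Prop. 2.7] [folklore]

This is piece G3' of the brief `Lines/Sketch-brief-Cdiv-subline.md`: regularity + dimension + r.s.p. of the chart `R[x/y]` of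
the blow-up of a regular curve `(x, y) ⊂` a 3-dimensional regular local `R` along the valuation ring `O`. -/
theorem locAtCentre_adjoin_div_of_rsop (O : ValuationSubring K) (R : Subring K) [IsRegularLocalRing R]
    (hRO : R ≤ O.toSubring) (hdom : SubringDominates R O.toSubring) (hdim : ringKrullDim R = 3)
    (x y z : R) (hxyz : maximalIdeal R = Ideal.span {x, y, z})
    (hv : O.valuation ((x : R) : K) < O.valuation ((y : R) : K))
    -- residually algebraic condition
    (halg : ∀ w : O, ∃ q : R[X], (∃ i, q.coeff i ∉ maximalIdeal R) ∧ O.valuation (aeval (w : K) q) < 1) :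
    let R' := locAtCentre (Subring.closure ((R : Set K) ∪ {((x : R) : K) / ((y : R) : K)})) O
    IsRegularLocalRing R' ∧
    ringKrullDim R' = 3 ∧
    SubringDominates R' O.toSubring := by
  intro R'
  -- Setup
  have hle := curveChart_le O R hRO _ _ hv.le
  haveI := isLocalRing_locAtCentre hle
  -- The spanFinrank of the maximal ideal of a regular local ring equals its dimension
  have hd : (maximalIdeal R).spanFinrank = 3 := by
    have h := Literature.RingTheory.KrullDimension.ringKrullDim_eq_spanFinrank (R := R)
    -- ringKrullDim R = ↑↑(spanFinrank) where the coercion goes ℕ → ℕ∞ → WithBot ℕ∞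
    rw [hdim] at h
    -- h : (3 : WithBot ℕ∞) = (↑↑spanFinrank : WithBot ℕ∞)
    -- Need to extract the natural number
    have h3 : (3 : WithBot ℕ∞) = ((3 : ℕ) : WithBot ℕ∞) := rfl
    rw [h3] at h
    exact (WithBot.coe_inj.mp (WithTop.coe_inj.mp h)).symm
  -- Build the Fin 3 → R function
  let xvec : Fin 3 → R := ![x, y, z]
  have hspan : Ideal.span (Set.range xvec) = maximalIdeal R := by
    rw [hxyz]
    simp only [xvec, Matrix.range_cons, Matrix.range_empty, Set.union_empty, Set.singleton_union,
      Set.pair_comm]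
  -- y ≠ 0 from the strict valuation inequality (v(x) < v(y) implies v(y) > 0, so y ≠ 0)
  have hy : (y : K) ≠ 0 := by
    intro h0
    simp only [h0, map_zero] at hv
    exact not_lt.mpr zero_le hv
  -- Part 1 & 3: R' is regular local and dominated (from CompositeCurveChart)
  have hreg : IsRegularLocalRing R' ∧ SubringDominates R' O.toSubring :=
    isRegularLocalRing_locAtCentre_curveChart O R hRO hd xvec hspan 0 1 (by decide) hv.le
  exact ⟨hreg.1, ringKrullDim_locAtCentre_curveChart_eq_three O R hRO hdom hdim x y hy hv.le halg, hreg.2⟩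

end Summit.ResolutionOfSingularities.ResolutionOfSingularities.Theorems.RadicialJung.CleanModels

end
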